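import Summits.HodgeConjecture.CorCM.Census.OcticTwistModel

/-!
# The octic twist `(ℤ/8 × B, (4,0))`, II: TRANSLATES AND FACES — motions on exponent vectors, stability of `hodge₂` / `pairs₂`, coset and mixed faces

COR-CM (cell `pub-hodgecm2`), count-neutral kernel combinatorics by the binder seat b09 (gen 33; lane COINVARIANT-TWIST / OCTIC RECON), part II
of the pair model (part I = `Census/OcticTwistModel.lean`: `Ty₂`, `tens`, `marg₀/₁`, `hodge₂`, `pairVec₂`, motions `act e h = tw₂ h ∘ sigᵉ`,
`actInv`, `actEquiv`, blocks `Orb₂`), on top of the quartic clock model (`Census/QuarticTwistModel.lean`, `Census/QuarticTwistSquares.lean`: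
`transl`, `transl_single`, `transl_faceVec`, `tw_flip`, `faceVec_mem`) used BY NAME.  One bookkeeping definition with body (`transl₂`) +
theorems; no `Prop`-valued definition, no `decide`, no certificate, no named fact, no `sorry`.
HONEST FRAMING: `HC_CM` is NOT proved, here or anywhere in the tree; nothing here is a period or a headline.

CONTENT.
* §1 **translation of exponent vectors** by a motion, `transl₂ e h v = v ∘ (act e h)⁻¹` (push-forward): `transl₂_single`
  (`e_T ↦ e_{act e h T}`), on outer products `transl₂ false h (v ⊗ w) = (h·v) ⊗ (h·w)` and **the swap**
  `transl₂ true h (v ⊗ w) = ((h + (1,0))·w) ⊗ (h·v)`; the marginals of translates (`marg₀/₁_transl₂_false/true`: diagonal motions translate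
  both marginals, the swap-twist EXCHANGES them up to the `(1,0)`-shift), hence **`hodge₂` and `pairs₂` are stable under every motion**
  (`transl₂_mem_hodge₂`, `transl₂_pairVec₂`, `transl₂_mem_pairs₂`).
* §2 **faces**: the COSET faces `(s; p, q) ⊗ e_t`, `e_s ⊗ (t; p, q)` (a quartic rank-four face in one coordinate, the other coordinate passive;
  the two places may share a column) and the MIXED faces `(e_s − e_{s^{(p)}}) ⊗ (e_t − e_{t^{(q)}})` (one place in each coset of `2ℤ/8 × B`,
  any columns) are octic Hodge vectors (`cface₀_mem_hodge₂`, `cface₁_mem_hodge₂`, `mface_mem_hodge₂`), and motions carry coset faces to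
  coset faces (the swap exchanging the coordinates: `transl₂_false/true_cface₀`) and mixed faces to mixed faces (`transl₂_false/true_mface`),
  via `transl_faceVec` / `tw_flip` of the quartic files.  These are exactly the images of the abstract rank-four faces of `(ℤ/8 × B, (4,0))`
  under seat b23ʼs `typePairEquiv` (`Census/IndexTwoDescentHodge.lean` §3, `Census/IndexTwoDescentMixed.lean`), for the transport.
DESIGN v0 of the generation theorem (lane note `HOME/pub-hodgecm2-b09/lean-g33/COINVARIANT-TWIST.md` PART B–C): one potential-reducing such
face per block off the ten residual blocks of `Φ(s₀) + Φ(s₁) ≤ 1`, plus nine closing faces — `β − 1` faces, numerically generating for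
`B = ℤ/2, ℤ/3`; the kernel generation theorem is the successor filesʼ business.

## References
* [Pohlmann1968] H. Pohlmann, Algebraic cycles on abelian varieties of complex multiplication type, Ann. of Math. 88 (1968), Thm 1.
* [Milne1999] J. S. Milne, Lefschetz motives and the Tate conjecture, Compositio Math. 117 (1999), Prop. 2.1, p. 54.
-/

namespace Summit.HodgeConjecture.CorCM.Census.OcticTwist

open Finset
open Summit.HodgeConjecture.CorCM.Census.QuarticTwist

variable (B : Type) [AddGroup B] [Fintype B] [DecidableEq B]

/-! ## §1 Translation of exponent vectors by motions -/

/-- **Translation** of an exponent vector by a motion (push-forward: `(g·v)(T) = v(g⁻¹ T)`). [folklore] -/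
def transl₂ (e : Bool) (h : ZMod 4 × B) (v : Ty₂ B → ℤ) : Ty₂ B → ℤ := fun T => v (actInv B e h T)

omit [Fintype B] [DecidableEq B] in
/-- `transl₂` as composition with the inverse permutation. [folklore] -/
theorem transl₂_eq_comp (e : Bool) (h : ZMod 4 × B) (v : Ty₂ B → ℤ) : transl₂ B e h v = v ∘ (actEquiv B e h).symm := rfl

omit [Fintype B] [DecidableEq B] in
/-- `transl₂` is additive. [folklore] -/
theorem transl₂_add (e : Bool) (h : ZMod 4 × B) (v w : Ty₂ B → ℤ) : transl₂ B e h (v + w) = transl₂ B e h v + transl₂ B e h w := rfl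

omit [Fintype B] [DecidableEq B] in
/-- `transl₂` commutes with subtraction. [folklore] -/
theorem transl₂_sub (e : Bool) (h : ZMod 4 × B) (v w : Ty₂ B → ℤ) : transl₂ B e h (v - w) = transl₂ B e h v - transl₂ B e h w := rfl

omit [Fintype B] [DecidableEq B] in
/-- `transl₂` commutes with scalars. [folklore] -/
theorem transl₂_smul (e : Bool) (h : ZMod 4 × B) (c : ℤ) (v : Ty₂ B → ℤ) : transl₂ B e h (c • v) = c • transl₂ B e h v := rfl

omit [DecidableEq B] in
/-- **A translate of a unit vector is the unit vector at the moved type.** [folklore] -/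
theorem transl₂_single (e : Bool) (h : ZMod 4 × B) (T : Ty₂ B) (c : ℤ) :
    transl₂ B e h (Pi.single T c) = Pi.single (act B e h T) c := by
  funext T'
  have hiff : actInv B e h T' = T ↔ T' = act B e h T := by
    constructor
    · intro h1
      rw [← h1, act_actInv]
    · intro h1
      rw [h1, actInv_act]
  simp only [transl₂, Pi.single_apply, hiff]

omit [Fintype B] [DecidableEq B] in
/-- **Diagonal translates of outer products**: `tw₂ h · (v ⊗ w) = (h·v) ⊗ (h·w)`. [folklore] -/
theorem transl₂_false_tens (h : ZMod 4 × B) (v w : Ty B → ℤ) :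
    transl₂ B false h (tens B v w) = tens B (transl B h v) (transl B h w) := by
  funext T
  rfl

omit [Fintype B] [DecidableEq B] in
/-- **The swap-twist on outer products**: `(tw₂ h ∘ sig) · (v ⊗ w) = ((h + (1,0))·w) ⊗ (h·v)`. [folklore] -/
theorem transl₂_true_tens (h : ZMod 4 × B) (v w : Ty B → ℤ) :
    transl₂ B true h (tens B v w) = tens B (transl B (h + (1, 0)) w) (transl B h v) := by
  funext T
  show v (tw B (-(1, 0) - h) (tw B (1, 0) T.2)) * w (tw B (-(1, 0) - h) T.1) = w (tw B (-(h + (1, 0))) T.1) * v (tw B (-h) T.2)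
  rw [tw_tw, neg_one_zero_sub, sub_add_cancel, neg_add_rev, ← neg_one_zero_sub, sub_eq_add_neg, mul_comm]

/-- First marginal of a diagonal translate. [folklore] -/
theorem marg₀_transl₂_false (h : ZMod 4 × B) (m : Ty₂ B → ℤ) : marg₀ B (transl₂ B false h m) = transl B h (marg₀ B m) := by
  funext s
  show ∑ t, m (tw B (-h) s, tw B (-h) t) = ∑ t, m (tw B (-h) s, t)
  exact Fintype.sum_equiv (twEquiv B (-h)) _ _ fun t => rfl

/-- Second marginal of a diagonal translate. [folklore] -/
theorem marg₁_transl₂_false (h : ZMod 4 × B) (m : Ty₂ B → ℤ) : marg₁ B (transl₂ B false h m) = transl B h (marg₁ B m) := by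
  funext t
  show ∑ s, m (tw B (-h) s, tw B (-h) t) = ∑ s, m (s, tw B (-h) t)
  exact Fintype.sum_equiv (twEquiv B (-h)) _ _ fun s => rfl

/-- First marginal of a swap-twisted translate: `marg₀ ((tw₂ h ∘ sig)·m) = (h + (1,0))·(marg₁ m)`. [folklore] -/
theorem marg₀_transl₂_true (h : ZMod 4 × B) (m : Ty₂ B → ℤ) :
    marg₀ B (transl₂ B true h m) = transl B (h + (1, 0)) (marg₁ B m) := by
  funext s
  show ∑ t, m (tw B (-(1, 0) - h) (tw B (1, 0) t), tw B (-(1, 0) - h) s) = ∑ t, m (t, tw B (-(h + (1, 0))) s)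
  have e1 : -(h + (1, 0)) = -(1, 0) - h := by rw [neg_add_rev, sub_eq_add_neg]
  rw [e1]
  refine Fintype.sum_equiv ((twEquiv B (1, 0)).trans (twEquiv B (-(1, 0) - h))) _ _ fun t => ?_
  rfl

/-- Second marginal of a swap-twisted translate: `marg₁ ((tw₂ h ∘ sig)·m) = h·(marg₀ m)`. [folklore] -/
theorem marg₁_transl₂_true (h : ZMod 4 × B) (m : Ty₂ B → ℤ) :
    marg₁ B (transl₂ B true h m) = transl B h (marg₀ B m) := by
  funext t
  show ∑ s, m (tw B (-(1, 0) - h) (tw B (1, 0) t), tw B (-(1, 0) - h) s) = ∑ s, m (tw B (-h) t, s)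
  rw [tw_tw, neg_one_zero_sub, sub_add_cancel]
  exact Fintype.sum_equiv (twEquiv B (-h - (1, 0))) _ _ fun s => rfl

/-- **The octic Hodge lattice is stable under all motions.** [folklore] -/
theorem transl₂_mem_hodge₂ {m : Ty₂ B → ℤ} (hm : m ∈ hodge₂ B) (e : Bool) (h : ZMod 4 × B) : transl₂ B e h m ∈ hodge₂ B := by
  rw [mem_hodge₂_iff] at hm ⊢
  cases e
  · rw [marg₀_transl₂_false, marg₁_transl₂_false]
    exact ⟨transl_mem B hm.1 h, transl_mem B hm.2 h⟩
  · rw [marg₀_transl₂_true, marg₁_transl₂_true]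
    exact ⟨transl_mem B hm.2 _, transl_mem B hm.1 h⟩

omit [DecidableEq B] in
/-- **A translate of an octic pair is the octic pair at the moved type.** [folklore] -/
theorem transl₂_pairVec₂ (e : Bool) (h : ZMod 4 × B) (T : Ty₂ B) : transl₂ B e h (pairVec₂ B T) = pairVec₂ B (act B e h T) := by
  unfold pairVec₂
  rw [transl₂_add, transl₂_single, transl₂_single, act_add_two]

omit [DecidableEq B] in
/-- **The octic pairs are stable under all motions.** [folklore] -/
theorem transl₂_mem_pairs₂ {v : Ty₂ B → ℤ} (hv : v ∈ pairs₂ B) (e : Bool) (h : ZMod 4 × B) : transl₂ B e h v ∈ pairs₂ B := by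
  induction hv using Submodule.span_induction with
  | mem x hx =>
    obtain ⟨T, rfl⟩ := hx
    rw [transl₂_pairVec₂]
    exact pairVec₂_mem_pairs₂ B _
  | zero => exact Submodule.zero_mem _
  | add x y _ _ hx hy =>
    rw [transl₂_add]
    exact Submodule.add_mem _ hx hy
  | smul c x _ hx =>
    rw [transl₂_smul]
    exact Submodule.smul_mem _ c hx

/-! ## §2 Faces: coset faces and mixed faces are octic Hodge vectors -/

omit [AddGroup B] in
/-- A quartic face class has mass zero. [folklore] -/
theorem sum_faceVec (s : Ty B) (p q : ZMod 2 × B) : ∑ x, faceVec B s p q x = 0 := by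
  unfold faceVec
  simp only [Pi.add_apply, Pi.sub_apply, sum_add_distrib, sum_sub_distrib, Finset.sum_pi_single', mem_univ, if_true]
  ring

omit [AddGroup B] in
/-- A difference of two unit vectors has mass zero. [folklore] -/
theorem sum_single_sub_single (s s' : Ty B) : ∑ x, (Pi.single s (1 : ℤ) - Pi.single s' (1 : ℤ) : Ty B → ℤ) x = 0 := by
  simp only [Pi.sub_apply, sum_sub_distrib, Finset.sum_pi_single', mem_univ, if_true, sub_self]

omit [AddGroup B] in
/-- **Coset faces in coordinate `0`** `(s; p, q) ⊗ e_t` are octic Hodge vectors (`p ≠ q`). [folklore] -/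
theorem cface₀_mem_hodge₂ (s : Ty B) {p q : ZMod 2 × B} (hpq : p ≠ q) (t : Ty B) :
    tens B (faceVec B s p q) (Pi.single t 1) ∈ hodge₂ B :=
  tens_mem_hodge₂_left B (faceVec_mem B s hpq) (sum_faceVec B s p q) _

omit [AddGroup B] in
/-- **Coset faces in coordinate `1`** `e_s ⊗ (t; p, q)` are octic Hodge vectors (`p ≠ q`). [folklore] -/
theorem cface₁_mem_hodge₂ (s t : Ty B) {p q : ZMod 2 × B} (hpq : p ≠ q) :
    tens B (Pi.single s 1) (faceVec B t p q) ∈ hodge₂ B :=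
  tens_mem_hodge₂_right B _ (faceVec_mem B t hpq) (sum_faceVec B t p q)

omit [AddGroup B] in
/-- **Mixed faces** `(e_s − e_{s^{(p)}}) ⊗ (e_t − e_{t^{(q)}})` (one place in each coset, ANY columns) are octic Hodge vectors. [folklore] -/
theorem mface_mem_hodge₂ (s t : Ty B) (p q : ZMod 2 × B) :
    tens B (Pi.single s 1 - Pi.single (QuarticTwist.flip B p s) 1) (Pi.single t 1 - Pi.single (QuarticTwist.flip B q t) 1) ∈ hodge₂ B :=
  tens_mem_hodge₂_of_sum_eq_zero B (sum_single_sub_single B _ _) (sum_single_sub_single B _ _)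

omit [AddGroup B] [Fintype B] [DecidableEq B] in
/-- The mixed face written out on the four corners `(s,t), (s^{(p)},t), (s,t^{(q)}), (s^{(p)},t^{(q)})`. [folklore] -/
theorem tens_sub_sub (v v' w w' : Ty B → ℤ) :
    tens B (v - v') (w - w') = tens B v w - tens B v' w - tens B v w' + tens B v' w' := by
  funext T
  show (v T.1 - v' T.1) * (w T.2 - w' T.2) = v T.1 * w T.2 - v' T.1 * w T.2 - v T.1 * w' T.2 + v' T.1 * w' T.2
  ring

/-- **Diagonal translates of coset faces are coset faces** (coordinate `0`). [folklore] -/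
theorem transl₂_false_cface₀ (h : ZMod 4 × B) (s : Ty B) (p q : ZMod 2 × B) (t : Ty B) :
    transl₂ B false h (tens B (faceVec B s p q) (Pi.single t 1)) =
      tens B (faceVec B (tw B h s) (plc B h p) (plc B h q)) (Pi.single (tw B h t) 1) := by
  rw [transl₂_false_tens, transl_faceVec, transl_single]

/-- **The swap-twist turns a coset face in coordinate `0` into a coset face in coordinate `1`.** [folklore] -/
theorem transl₂_true_cface₀ (h : ZMod 4 × B) (s : Ty B) (p q : ZMod 2 × B) (t : Ty B) :
    transl₂ B true h (tens B (faceVec B s p q) (Pi.single t 1)) =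
      tens B (Pi.single (tw B (h + (1, 0)) t) 1) (faceVec B (tw B h s) (plc B h p) (plc B h q)) := by
  rw [transl₂_true_tens, transl_faceVec, transl_single]

/-- **Diagonal translates of mixed faces are mixed faces.** [folklore] -/
theorem transl₂_false_mface (h : ZMod 4 × B) (s t : Ty B) (p q : ZMod 2 × B) :
    transl₂ B false h (tens B (Pi.single s 1 - Pi.single (QuarticTwist.flip B p s) 1) (Pi.single t 1 - Pi.single (QuarticTwist.flip B q t) 1)) =
      tens B (Pi.single (tw B h s) 1 - Pi.single (QuarticTwist.flip B (plc B h p) (tw B h s)) 1)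
        (Pi.single (tw B h t) 1 - Pi.single (QuarticTwist.flip B (plc B h q) (tw B h t)) 1) := by
  rw [transl₂_false_tens, transl_sub, transl_sub, transl_single, transl_single, transl_single, transl_single, tw_flip, tw_flip]
  rfl

/-- **The swap-twist carries mixed faces to mixed faces** (the two places exchange cosets). [folklore] -/
theorem transl₂_true_mface (h : ZMod 4 × B) (s t : Ty B) (p q : ZMod 2 × B) :
    transl₂ B true h (tens B (Pi.single s 1 - Pi.single (QuarticTwist.flip B p s) 1) (Pi.single t 1 - Pi.single (QuarticTwist.flip B q t) 1)) =
      tens B (Pi.single (tw B (h + (1, 0)) t) 1 - Pi.single (QuarticTwist.flip B (plc B (h + (1, 0)) q) (tw B (h + (1, 0)) t)) 1)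
        (Pi.single (tw B h s) 1 - Pi.single (QuarticTwist.flip B (plc B h p) (tw B h s)) 1) := by
  rw [transl₂_true_tens, transl_sub, transl_sub, transl_single, transl_single, transl_single, transl_single, tw_flip, tw_flip]
  rfl

end Summit.HodgeConjecture.CorCM.Census.OcticTwist
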